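/-
Copyright (c) 2026 the pub-hodgecm-mathlib formalisation cell (harness21).  Prover seat hodgecm-mathlib-K2E5-p12 (g2), HCML Track B «K2-LIT», h413 =
`stmt-HodgeConjecture-24833`, line `K2_E3_EllipticInputs`, unit U3b, sub-line (ii♭-H) «RANK-ONE CAYLEY ROAD», letter (SC₂) — FILE 4 of 5: THE ASSEMBLY — the rank-one
scaling law ‹SC₂-explicit› UNCONDITIONALLY.  2026-09-04.
-/
import Summits.HodgeConjecture.HodgeConjecture.Theorems.K2E3RankOneTransvectionScalingHaar      -- ★ FILE 3 (this seat): `exists_haar_index_identity_of_transvection_two`; brings FILE 1∕2, ★ p855558 §1 (`inverseWindow_of_sub_one_mul_self_eq_zero`, …)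
import Summits.HodgeConjecture.HodgeConjecture.Theorems.K2E3CayleyScalingRankOnePackage         -- ★ p855890 (K2E5-p12 (g0)): the consumer `psiPackage_of_scalingLaw_local_two` ∕ `_two`; brings ★ FILE 1∕2 of the rank-one ball (p855742∕p855813)
import Summits.HodgeConjecture.HodgeConjecture.Theorems.K2E3UnipotentOrbitalScalingLaw          -- ★ p855982 (K2E3-p21): `exists_valued_eq_exp_neg`; brings ★ Prelims p855882 §4 (identity class), ★ p855586 (F2⁻), ★ p855798 (transport), ★ p855453 §2 (glue), ★ instances ∕ unimodularity ∕ one-place lemmas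
import HarnessLib

/-!
# h413 ∕ K2-LIT, line `K2_E3_EllipticInputs`, unit U3b, (ii♭-H): THE SCALING LAW OF THE UNIPOTENT ORBITAL INTEGRALS OF `U(Φ₂)(L⁺_v)` — ‹SC₂-explicit› HOLDS
# (FILE 4, the assembly)

Cell `pub/hodgecm-mathlib`, crux H413 = `stmt-HodgeConjecture-24833`, route of record `HCCMUnconditional`; chair K2-lead (g0), line lead (ii′) K2E4-p06 (g2), dealers
K2E3-plan ∕ K2E5-plan.  THEOREMS ONLY (no `def`, no `instance`, no `notation`, no named-fact hypothesis, no `sorry`); imports = ★ + HarnessLib; lane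
`--supports stmt-HodgeConjecture-24833 --as helper` (count-neutral).

THE STATEMENT.  `scalingLaw_local_two : ‹SC₂-explicit›`, TOKEN FOR TOKEN the hypothesis `hSC` of ★ p855890 `K2E3CayleyScalingRankOnePackage.psiPackage_of_scalingLaw_local_two`
(carrier `↥(«local» L c 2 Φ₂ v)`), with NO hypothesis: at every non-split `v` there are `w, hw, s, ρ, q, a` such that for every ADMISSIBLE pair `(Ψ, U₀)` (`hU`: `U₀` is the
rank-one eigenvalue ball of radius `ρ` read at `w`; `hΨ`: `mat(e(Ψγ)) = c(s•X_{eγ})` on `U₀`) the unipotent orbital integrals scale by `q^{a u}`: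
`Φ_{mU}(u, 1_{U₀}·(F∘Ψ)) = q^{a u}·Φ_{mU}(u, F)`.  The corollaries ‹Ψ-package›₂ on both carriers (★ p855890 applied) are the sequel `K2E3CayleyScalingRankOnePackageHolds`
(400-line rule); the closing `example` certifies the docking into ★ p855890 here.

THE WITNESSES (K2E3-p03's recipe, rank one).  `w` any place above `v` (★ `PlacesOver.nonempty`), `t := p ∈ L_w` the residue characteristic of `v` (★ `resChar`: `σ_w`-fixed,
non-zero, `|t|_w = exp(−k)`, `k ≥ 1`), `s := t·t`, `ρ := 1∕2`, `q := Q := (#𝓀[L_w])^k ∈ ℕ ⊂ ℂ` (`> 1`), and `a u := 0` on the identity class, `1` elsewhere — in rank one EVERY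
unipotent `u ≠ 1` is a transvection (`(g − 1)² = 0`), and HC's exponent is `d(u)∕2 = 1` relative to `Q` (ONE factor `[𝔤₋(𝒪) : t²𝔤₋(𝒪)] = Q`, ★ p855586 (F2⁻) ALONE).

THE PROOF.  Given `(Ψ, U₀)` admissible and a unipotent class `u ∈ S` with representative `u₀ = out u` (`(mat − 1)² = 0` read at `w`, ★ `apply_eq_zero_iff_apply_apply_eq_zero`):
§1 gives `u₀ ∈ U₀`, all its conjugates in `U₀` (`hU`), (E) on `U₀` (`hE`, `map_conj_eq_conj_map_two`), `Ψ 1 = 1` (`map_one_eq_one_two`).  IDENTITY: ★ Prelims §4, `a = 0`.  TRANSVECTION: ★ FILE 3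
`exists_haar_index_identity_of_transvection_two` at `e u₀` (hypotheses `σ_w` isometric involution, `2 ≠ 0`, `t`, (F2⁻)) gives `h′, K′, ρ′` in the model with `r = Q`; §1 turns
(i′) into `e(Ψ u₀) = h′·e u₀·h′⁻¹`, ★ p855798 transports to `G`, and ★ p855453 §2 (two-sided Haar `ν`, ★ `isMulRightInvariant_cmDatum_local_antidiagOne L 2 v`; admissibility
of `mU` at `u`) yields `Φ(u, 1_{U₀}·(F∘Ψ)) = Q·Φ(u, F)`, `Q = q^{a u}`.  NO dyadic residual: the rank-one count holds in every residue characteristic (★ FILE 2).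

HONEST LABEL.  HC_CM is proved only modulo the 7 printed citations (2 remaining named inputs: hLiu418 = `stmt-HodgeConjecture-24832`, h413 =
`stmt-HodgeConjecture-24833`) until rung 0 closes.  With this file the rank-one Cayley road is ★ end to end: (Ψ-package♮)'s scaling-law input (SC₂) is DISCHARGED;
count-neutral helper.

## References
* [HarishChandra1999AdmissibleDistributions] Harish-Chandra, *Admissible Invariant Distributions on Reductive p-adic Groups*, ULS 16 (1999), §3.1 Lemma 3.2 (homogeneity).
* [Rogawski1990] J. D. Rogawski, *Automorphic Representations of Unitary Groups in Three Variables* (1990), §8.1 Prop. 8.1.2 (b) p. 114; (8.1.1) p. 116; §3.9 p. 32.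
* [PlatonovRapinchuk1994] V. Platonov, A. Rapinchuk, *Algebraic Groups and Number Theory* (1994), §3.3, §5.1.
-/

set_option autoImplicit false
set_option linter.dupNamespace false  -- the mandated namespace repeats the single-problem summit's segment (`HodgeConjecture.HodgeConjecture`)

noncomputable section

open NumberField IsDedekindDomain MeasureTheory Filter Topology Set Polynomial
open scoped Matrix MatrixGroups ENNReal NNReal Valued WithZero
open Literature.NumberTheory.Rogawski1990 Literature.NumberTheory.Automorphic Literature.NumberTheory.Automorphic.UnitaryGroup
open Literature.NumberTheory.Weil1982.UnitaryFinTopForm Literature.MeasureTheory.Group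
open Summit.HodgeConjecture.HodgeConjecture.Cruxes.H413.K2E3CayleyScalingRankOne Summit.HodgeConjecture.HodgeConjecture.Cruxes.H413.K2E3CayleyScalingRankOneMap
open Summit.HodgeConjecture.HodgeConjecture.Cruxes.H413.K2E3CayleyScalingRankOnePackage
open Summit.HodgeConjecture.HodgeConjecture.Cruxes.H413.K2E3UnipotentOrbitalScalingTransvection
open Summit.HodgeConjecture.HodgeConjecture.Cruxes.H413.K2E3RankOneTransvectionScalingHaar
open Summit.HodgeConjecture.HodgeConjecture.Cruxes.H413.K2E3UnipotentOrbitalScalingLawPrelims (out_mk_one_eq_one classOrbitalIntegral_indicator_comp_eq_of_mk_one)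
open Summit.HodgeConjecture.HodgeConjecture.Cruxes.H413.K2E3LocalLatticeScalingIndex (relIndex_map_mulLeft_skewBall_eq_pow)
open Summit.HodgeConjecture.HodgeConjecture.Cruxes.H413.K2E3OrbitalScalingDataTransport (exists_scalingData_of_continuousMulEquiv)
open Summit.HodgeConjecture.HodgeConjecture.Cruxes.H413.K2E3UnipotentOrbitalScalingOfIndex (classOrbitalIntegral_indicator_comp_eq_mul_of_conj_of_index)
open Summit.HodgeConjecture.HodgeConjecture.Cruxes.H413.K2E3UnipotentOrbitalScalingLaw (exists_valued_eq_exp_neg)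

namespace Summit.HodgeConjecture.HodgeConjecture.Cruxes.H413.K2E3CayleyScalingLawRankOne

/-! ## §1 Reading the ‹SC₂-explicit› letters through `e : G ≃ₜ* U(σ, J)(K)` (rank one) -/

section Model

variable {G : Type*} [Group G] [TopologicalSpace G] {K : Type*} [NormedField K] [IsUltrametricDist K] {σ : K →+* K} {J : Matrix (Fin 2) (Fin 2) K} {ρ : ℝ} {s : K}
  {B : Set ↥(unitaryGroupOfForm σ J)}
  (hB : ∀ u : ↥(unitaryGroupOfForm σ J), u ∈ B ↔
    IsUnit (((u : GL (Fin 2) K) : Matrix (Fin 2) (Fin 2) K) + 1).det ∧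
    ‖((((u : GL (Fin 2) K) : Matrix (Fin 2) (Fin 2) K) - 1) * (((u : GL (Fin 2) K) : Matrix (Fin 2) (Fin 2) K) + 1)⁻¹).trace‖ ≤ ρ ∧
    ‖((((u : GL (Fin 2) K) : Matrix (Fin 2) (Fin 2) K) - 1) * (((u : GL (Fin 2) K) : Matrix (Fin 2) (Fin 2) K) + 1)⁻¹).det‖ ≤ ρ ^ 2)
  (e : G ≃ₜ* ↥(unitaryGroupOfForm σ J)) {U₀ : Set G} (hU₀ : ∀ γ : G, γ ∈ U₀ ↔ e γ ∈ B)
  {Ψ : G → G}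
  (hΨ₀ : ∀ γ ∈ U₀, (((e (Ψ γ) : ↥(unitaryGroupOfForm σ J)) : GL (Fin 2) K) : Matrix (Fin 2) (Fin 2) K) =
    cayley (s • (((((e γ : ↥(unitaryGroupOfForm σ J)) : GL (Fin 2) K) : Matrix (Fin 2) (Fin 2) K) - 1) * ((((e γ : ↥(unitaryGroupOfForm σ J)) : GL (Fin 2) K) : Matrix (Fin 2) (Fin 2) K) + 1)⁻¹)))

include hB in
omit [IsUltrametricDist K] in
/-- **Every unipotent element of `U(σ, J)(K)` lies in the rank-one eigenvalue ball `B`** (any `J`, `0 ≤ ρ`, `2 ≠ 0`): with `N = g − 1` nilpotent, `g + 1 = 2·(1 + 2⁻¹N)` is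
invertible and `X_u = N(g + 1)⁻¹` is nilpotent, so `χ_{X_u} = T²` (Mathlib `Matrix.isNilpotent_charpoly_sub_pow_of_isNilpotent`), i.e. `tr X_u = 0 = det X_u`.  The rank-one twin
of ★ frame `mem_ball_of_isNilpotent`. [cite: PlatonovRapinchuk1994, §3.3] -/
theorem mem_ball_of_isNilpotent_two (hρ : 0 ≤ ρ) (h2 : (2 : K) ≠ 0) {u : ↥(unitaryGroupOfForm σ J)}
    (hnil : IsNilpotent (((u : GL (Fin 2) K) : Matrix (Fin 2) (Fin 2) K) - 1)) : u ∈ B := by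
  rw [hB]
  set g : Matrix (Fin 2) (Fin 2) K := ((u : GL (Fin 2) K) : Matrix (Fin 2) (Fin 2) K) with hg
  set N : Matrix (Fin 2) (Fin 2) K := g - 1 with hN
  have h1 : IsUnit (1 + (2⁻¹ : K) • N) := (hnil.smul (2⁻¹ : K)).isUnit_one_add
  have hg1 : g + 1 = (2 : K) • (1 + (2⁻¹ : K) • N) := by
    rw [smul_add, smul_smul, mul_inv_cancel₀ h2, one_smul, two_smul, hN]; abel
  have hP : IsUnit (g + 1).det := by
    rw [hg1, Matrix.det_smul, Fintype.card_fin]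
    exact ((isUnit_iff_ne_zero.2 h2).pow 2).mul ((Matrix.isUnit_iff_isUnit_det _).1 h1)
  have hcomm : Commute N (g + 1)⁻¹ := by
    have hm : (g + 1) * (g + 1)⁻¹ = 1 := Matrix.mul_nonsing_inv _ hP
    have hm' : (g + 1)⁻¹ * (g + 1) = 1 := Matrix.nonsing_inv_mul _ hP
    have hNg : N = (g + 1) - (2 : K) • 1 := by rw [hN, two_smul]; abel
    change N * (g + 1)⁻¹ = (g + 1)⁻¹ * N
    rw [hNg, Matrix.sub_mul, Matrix.mul_sub, hm, hm', Matrix.smul_mul, Matrix.mul_smul, Matrix.one_mul, Matrix.mul_one]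
  have hX : IsNilpotent (N * (g + 1)⁻¹) := hcomm.isNilpotent_mul_right hnil
  have hchar : (N * (g + 1)⁻¹).charpoly = X ^ 2 := by
    have h := (Matrix.isNilpotent_charpoly_sub_pow_of_isNilpotent hX).eq_zero
    rwa [Fintype.card_fin, sub_eq_zero] at h
  have htr : (N * (g + 1)⁻¹).trace = 0 := by
    rw [Matrix.trace_eq_neg_charpoly_coeff, hchar, Fintype.card_fin, coeff_X_pow, if_neg (by omega), neg_zero]
  have hdet : (N * (g + 1)⁻¹).det = 0 := by
    rw [Matrix.det_eq_sign_charpoly_coeff, hchar, coeff_X_pow, if_neg (by omega), mul_zero]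
  refine ⟨hP, ?_, ?_⟩
  · rw [htr, norm_zero]; exact hρ
  · rw [hdet, norm_zero]; exact pow_nonneg hρ 2

include hB hU₀ in
omit [IsUltrametricDist K] in
/-- **A unipotent `γ ∈ G` (read through `e`) lies in `U₀`** (`0 ≤ ρ`, `2 ≠ 0`). [cite: PlatonovRapinchuk1994, §3.3] -/
theorem mem_of_isNilpotent (hρ : 0 ≤ ρ) (h2 : (2 : K) ≠ 0) {γ : G}
    (hnil : IsNilpotent ((((e γ : ↥(unitaryGroupOfForm σ J)) : GL (Fin 2) K) : Matrix (Fin 2) (Fin 2) K) - 1)) : γ ∈ U₀ :=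
  (hU₀ γ).2 (mem_ball_of_isNilpotent_two hB hρ h2 hnil)

include hB hU₀ in
omit [IsUltrametricDist K] in
/-- **Every conjugate of a unipotent `γ` lies in `U₀`** (the `hU` letter of ★ p855453 §2; ★ `isNilpotent_coe_conj_sub_one`). [cite: PlatonovRapinchuk1994, §3.3] -/
theorem conj_mem_of_isNilpotent (hρ : 0 ≤ ρ) (h2 : (2 : K) ≠ 0) {γ : G}
    (hnil : IsNilpotent ((((e γ : ↥(unitaryGroupOfForm σ J)) : GL (Fin 2) K) : Matrix (Fin 2) (Fin 2) K) - 1)) (x : G) : x * γ * x⁻¹ ∈ U₀ := by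
  refine mem_of_isNilpotent hB e hU₀ hρ h2 ?_
  rw [map_mul, map_mul, map_inv, Subgroup.coe_mul, Subgroup.coe_mul, Subgroup.coe_inv]
  exact isNilpotent_coe_conj_sub_one _ hnil

include hB hU₀ hΨ₀ in
/-- **`Ψ′ := e ∘ Ψ ∘ e⁻¹` satisfies the two-conjunct letter `hΨ` of ★ FILE 2 (p855813) on `B`**: `mat(Ψ′u) = c(s•X_u)` and `mat((Ψ′u)⁻¹) = c(−s•X_u)` (★ `cayley_mul_cayley_neg`,
side conditions ★ `isUnit_of_mem_ball` since `‖s‖ρ < 1`). [cite: PlatonovRapinchuk1994, §3.3] -/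
theorem coe_map_symm_and_inv (hsρ : ‖s‖ * ρ < 1) (u : ↥(unitaryGroupOfForm σ J)) (hu : u ∈ B) :
    (((e (Ψ (e.symm u)) : ↥(unitaryGroupOfForm σ J)) : GL (Fin 2) K) : Matrix (Fin 2) (Fin 2) K) =
        cayley (s • ((((u : GL (Fin 2) K) : Matrix (Fin 2) (Fin 2) K) - 1) * (((u : GL (Fin 2) K) : Matrix (Fin 2) (Fin 2) K) + 1)⁻¹)) ∧
    ((((e (Ψ (e.symm u)) : ↥(unitaryGroupOfForm σ J)) : GL (Fin 2) K)⁻¹ : GL (Fin 2) K) : Matrix (Fin 2) (Fin 2) K) =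
        cayley (-(s • ((((u : GL (Fin 2) K) : Matrix (Fin 2) (Fin 2) K) - 1) * (((u : GL (Fin 2) K) : Matrix (Fin 2) (Fin 2) K) + 1)⁻¹))) := by
  have hu' : e.symm u ∈ U₀ := by rw [hU₀, ContinuousMulEquiv.apply_symm_apply]; exact hu
  have h1 := hΨ₀ _ hu'
  rw [ContinuousMulEquiv.apply_symm_apply] at h1
  obtain ⟨-, hm, hp⟩ := isUnit_of_mem_ball σ J hB hsρ hu
  refine ⟨h1, ?_⟩
  rw [Matrix.coe_units_inv, h1]
  exact Matrix.inv_eq_right_inv (cayley_mul_cayley_neg hm hp)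

include hB hU₀ hΨ₀ in
/-- **(E) ON `G`: `Ψ(xγx⁻¹) = x·Ψ(γ)·x⁻¹` for `γ ∈ U₀`** (the `hE` letter of ★ p855453 §2) — ★ FILE 2 `cayleyScaling_conj_mem` for `Ψ′ = e ∘ Ψ ∘ e⁻¹` on `B`, pulled back along `e`.
[cite: PlatonovRapinchuk1994, §3.3] [cite: HarishChandra1999AdmissibleDistributions, §3.1 Lemma 3.2] -/
theorem map_conj_eq_conj_map_two (hsρ : ‖s‖ * ρ < 1) {γ : G} (hγ : γ ∈ U₀) (x : G) : Ψ (x * γ * x⁻¹) = x * (Ψ γ) * x⁻¹ := by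
  have hΨ' := coe_map_symm_and_inv hB e hU₀ hΨ₀ hsρ
  have key := (cayleyScaling_conj_mem σ J hB (Ψ := fun u => e (Ψ (e.symm u))) hΨ' hsρ ((hU₀ γ).1 hγ) (e x)).2
  simp only [← map_mul, ← map_inv, ContinuousMulEquiv.symm_apply_apply] at key
  exact e.injective key

include hB hU₀ hΨ₀ in
omit [IsUltrametricDist K] in
/-- **`Ψ 1 = 1`**: `mat(e(Ψ 1)) = c(s • X_1) = c(0) = 1 = mat(e 1)`. [cite: PlatonovRapinchuk1994, §3.3] -/
theorem map_one_eq_one_two (hρ : 0 ≤ ρ) (h2 : (2 : K) ≠ 0) : Ψ (1 : G) = (1 : G) := by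
  have h1 := hΨ₀ 1 (mem_of_isNilpotent hB e hU₀ hρ h2 (by rw [map_one]; exact ⟨1, by simp⟩))
  rw [map_one, show (((1 : ↥(unitaryGroupOfForm σ J)) : GL (Fin 2) K) : Matrix (Fin 2) (Fin 2) K) = 1 from rfl, sub_self, Matrix.zero_mul,
    smul_zero, cayley_def, add_zero, sub_zero, inv_one, Matrix.mul_one] at h1
  apply e.injective
  rw [map_one]
  exact Subtype.ext (Units.ext h1)

include hΨ₀ in
omit [IsUltrametricDist K] in
/-- **(i′) ⟹ the `hΨ′` letter of the transport**: if `u₀ ∈ U₀` and `mat(h′·e u₀·h′⁻¹) = c(s • X_{e u₀})` (★ FILE 3, `s = t·t`), then `e (Ψ u₀) = h′·e u₀·h′⁻¹`.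
[cite: HarishChandra1999AdmissibleDistributions, §3.1 Lemma 3.2] -/
theorem map_eq_conj_of_coe_conj_eq {u₀ : G} (hu₀ : u₀ ∈ U₀) {h' : ↥(unitaryGroupOfForm σ J)}
    (hmat : (((h' * e u₀ * h'⁻¹ : ↥(unitaryGroupOfForm σ J)) : GL (Fin 2) K) : Matrix (Fin 2) (Fin 2) K) =
      cayley (s • (((((e u₀ : ↥(unitaryGroupOfForm σ J)) : GL (Fin 2) K) : Matrix (Fin 2) (Fin 2) K) - 1) * ((((e u₀ : ↥(unitaryGroupOfForm σ J)) : GL (Fin 2) K) : Matrix (Fin 2) (Fin 2) K) + 1)⁻¹))) :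
    e (Ψ u₀) = h' * e u₀ * h'⁻¹ :=
  Subtype.ext (Units.ext (by rw [hΨ₀ u₀ hu₀, hmat]))

end Model

/-! ## §2 The head: ‹SC₂-explicit› holds -/

set_option maxHeartbeats 1600000 in
/-- **THE SCALING LAW OF THE UNIPOTENT ORBITAL INTEGRALS OF `U(Φ₂)(L⁺_v)` (‹SC₂-explicit›, UNCONDITIONAL).**  The statement is the hypothesis `hSC` of ★ p855890
`psiPackage_of_scalingLaw_local_two` TOKEN FOR TOKEN.  Witnesses and proof: see the module docstring (identity ∕ transvection branches over §1, ★ FILE 3, ★ p855586 (F2⁻),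
★ p855798, ★ p855453 §2). [cite: HarishChandra1999AdmissibleDistributions, §3.1 Lemma 3.2] [cite: Rogawski1990, §8.1 Prop. 8.1.2 (b) p. 114] [cite: PlatonovRapinchuk1994, §3.3; §5.1] -/
theorem scalingLaw_local_two :
    ∀ (L : Type) [Field L] [NumberField L] [IsCMField L] (v : HeightOneSpectrum (𝓞 ↥(maximalRealSubfield L))),
      (∀ w : PlacesOver L v, IsCMField.complexConj L • w.1 = w.1) →
      ∀ [MeasurableSpace (↥(«local» L (IsCMField.complexConj L) 2 (Matrix.of fun i j : Fin 2 => if i.val + j.val + 1 = 2 then (1 : L) else 0) v))]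
        [BorelSpace (↥(«local» L (IsCMField.complexConj L) 2 (Matrix.of fun i j : Fin 2 => if i.val + j.val + 1 = 2 then (1 : L) else 0) v))]
        [∀ γ : ↥(«local» L (IsCMField.complexConj L) 2 (Matrix.of fun i j : Fin 2 => if i.val + j.val + 1 = 2 then (1 : L) else 0) v),
          MeasurableSpace (↥(«local» L (IsCMField.complexConj L) 2 (Matrix.of fun i j : Fin 2 => if i.val + j.val + 1 = 2 then (1 : L) else 0) v) ⧸
            Subgroup.centralizer ({γ} : Set (↥(«local» L (IsCMField.complexConj L) 2 (Matrix.of fun i j : Fin 2 => if i.val + j.val + 1 = 2 then (1 : L) else 0) v))))]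
        [∀ γ : ↥(«local» L (IsCMField.complexConj L) 2 (Matrix.of fun i j : Fin 2 => if i.val + j.val + 1 = 2 then (1 : L) else 0) v),
          BorelSpace (↥(«local» L (IsCMField.complexConj L) 2 (Matrix.of fun i j : Fin 2 => if i.val + j.val + 1 = 2 then (1 : L) else 0) v) ⧸
            Subgroup.centralizer ({γ} : Set (↥(«local» L (IsCMField.complexConj L) 2 (Matrix.of fun i j : Fin 2 => if i.val + j.val + 1 = 2 then (1 : L) else 0) v))))],
      ∃ (w : PlacesOver L v) (hw : IsCMField.complexConj L • w.1 = w.1) (s : w.1.adicCompletion L) (ρ : ℝ) (q : ℂ)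
        (a : ConjClasses (↥(«local» L (IsCMField.complexConj L) 2 (Matrix.of fun i j : Fin 2 => if i.val + j.val + 1 = 2 then (1 : L) else 0) v)) → ℕ),
        galAdicCompletionMap (L := L) (IsCMField.complexConj L) hw s = s ∧ s ≠ 0 ∧ ‖s‖ < 1 ∧ 0 < ρ ∧ ρ < 1 ∧ 1 < ‖q‖ ∧
        (∀ u : ConjClasses (↥(«local» L (IsCMField.complexConj L) 2 (Matrix.of fun i j : Fin 2 => if i.val + j.val + 1 = 2 then (1 : L) else 0) v)), u ≠ ConjClasses.mk 1 → 1 ≤ a u) ∧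
        ∀ (Ψ : ↥(«local» L (IsCMField.complexConj L) 2 (Matrix.of fun i j : Fin 2 => if i.val + j.val + 1 = 2 then (1 : L) else 0) v) →
            ↥(«local» L (IsCMField.complexConj L) 2 (Matrix.of fun i j : Fin 2 => if i.val + j.val + 1 = 2 then (1 : L) else 0) v))
          (U₀ : Set (↥(«local» L (IsCMField.complexConj L) 2 (Matrix.of fun i j : Fin 2 => if i.val + j.val + 1 = 2 then (1 : L) else 0) v))),
          (∀ γ : ↥(«local» L (IsCMField.complexConj L) 2 (Matrix.of fun i j : Fin 2 => if i.val + j.val + 1 = 2 then (1 : L) else 0) v), γ ∈ U₀ ↔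
            IsUnit ((((localNonsplitEquiv (IsCMField.complexConj L) (Matrix.of fun i j : Fin 2 => if i.val + j.val + 1 = 2 then (1 : L) else 0) (IsCMField.complexConj_ne_one L) w hw γ :
                ↥(unitaryGroupOfForm (galAdicCompletionMap (L := L) (IsCMField.complexConj L) hw) (placeForm (Matrix.of fun i j : Fin 2 => if i.val + j.val + 1 = 2 then (1 : L) else 0) w.1))) :
                  GL (Fin 2) (w.1.adicCompletion L)) : Matrix (Fin 2) (Fin 2) (w.1.adicCompletion L)) + 1).det ∧
            ‖(((((localNonsplitEquiv (IsCMField.complexConj L) (Matrix.of fun i j : Fin 2 => if i.val + j.val + 1 = 2 then (1 : L) else 0) (IsCMField.complexConj_ne_one L) w hw γ :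
                ↥(unitaryGroupOfForm (galAdicCompletionMap (L := L) (IsCMField.complexConj L) hw) (placeForm (Matrix.of fun i j : Fin 2 => if i.val + j.val + 1 = 2 then (1 : L) else 0) w.1))) :
                  GL (Fin 2) (w.1.adicCompletion L)) : Matrix (Fin 2) (Fin 2) (w.1.adicCompletion L)) - 1) *
                ((((localNonsplitEquiv (IsCMField.complexConj L) (Matrix.of fun i j : Fin 2 => if i.val + j.val + 1 = 2 then (1 : L) else 0) (IsCMField.complexConj_ne_one L) w hw γ :
                ↥(unitaryGroupOfForm (galAdicCompletionMap (L := L) (IsCMField.complexConj L) hw) (placeForm (Matrix.of fun i j : Fin 2 => if i.val + j.val + 1 = 2 then (1 : L) else 0) w.1))) :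
                  GL (Fin 2) (w.1.adicCompletion L)) : Matrix (Fin 2) (Fin 2) (w.1.adicCompletion L)) + 1)⁻¹).trace‖ ≤ ρ ∧
            ‖(((((localNonsplitEquiv (IsCMField.complexConj L) (Matrix.of fun i j : Fin 2 => if i.val + j.val + 1 = 2 then (1 : L) else 0) (IsCMField.complexConj_ne_one L) w hw γ :
                ↥(unitaryGroupOfForm (galAdicCompletionMap (L := L) (IsCMField.complexConj L) hw) (placeForm (Matrix.of fun i j : Fin 2 => if i.val + j.val + 1 = 2 then (1 : L) else 0) w.1))) :
                  GL (Fin 2) (w.1.adicCompletion L)) : Matrix (Fin 2) (Fin 2) (w.1.adicCompletion L)) - 1) *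
                ((((localNonsplitEquiv (IsCMField.complexConj L) (Matrix.of fun i j : Fin 2 => if i.val + j.val + 1 = 2 then (1 : L) else 0) (IsCMField.complexConj_ne_one L) w hw γ :
                ↥(unitaryGroupOfForm (galAdicCompletionMap (L := L) (IsCMField.complexConj L) hw) (placeForm (Matrix.of fun i j : Fin 2 => if i.val + j.val + 1 = 2 then (1 : L) else 0) w.1))) :
                  GL (Fin 2) (w.1.adicCompletion L)) : Matrix (Fin 2) (Fin 2) (w.1.adicCompletion L)) + 1)⁻¹).det‖ ≤ ρ ^ 2) →
          (∀ γ ∈ U₀,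
            (((localNonsplitEquiv (IsCMField.complexConj L) (Matrix.of fun i j : Fin 2 => if i.val + j.val + 1 = 2 then (1 : L) else 0) (IsCMField.complexConj_ne_one L) w hw (Ψ γ) :
                ↥(unitaryGroupOfForm (galAdicCompletionMap (L := L) (IsCMField.complexConj L) hw) (placeForm (Matrix.of fun i j : Fin 2 => if i.val + j.val + 1 = 2 then (1 : L) else 0) w.1))) :
                  GL (Fin 2) (w.1.adicCompletion L)) : Matrix (Fin 2) (Fin 2) (w.1.adicCompletion L)) =
              cayley (s • (((((localNonsplitEquiv (IsCMField.complexConj L) (Matrix.of fun i j : Fin 2 => if i.val + j.val + 1 = 2 then (1 : L) else 0) (IsCMField.complexConj_ne_one L) w hw γ :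
                ↥(unitaryGroupOfForm (galAdicCompletionMap (L := L) (IsCMField.complexConj L) hw) (placeForm (Matrix.of fun i j : Fin 2 => if i.val + j.val + 1 = 2 then (1 : L) else 0) w.1))) :
                  GL (Fin 2) (w.1.adicCompletion L)) : Matrix (Fin 2) (Fin 2) (w.1.adicCompletion L)) - 1) *
                ((((localNonsplitEquiv (IsCMField.complexConj L) (Matrix.of fun i j : Fin 2 => if i.val + j.val + 1 = 2 then (1 : L) else 0) (IsCMField.complexConj_ne_one L) w hw γ :
                ↥(unitaryGroupOfForm (galAdicCompletionMap (L := L) (IsCMField.complexConj L) hw) (placeForm (Matrix.of fun i j : Fin 2 => if i.val + j.val + 1 = 2 then (1 : L) else 0) w.1))) :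
                  GL (Fin 2) (w.1.adicCompletion L)) : Matrix (Fin 2) (Fin 2) (w.1.adicCompletion L)) + 1)⁻¹))) →
          ∀ (S : Finset (ConjClasses (↥(«local» L (IsCMField.complexConj L) 2 (Matrix.of fun i j : Fin 2 => if i.val + j.val + 1 = 2 then (1 : L) else 0) v))))
            (mU : OrbitalMeasureFamily (↥(«local» L (IsCMField.complexConj L) 2 (Matrix.of fun i j : Fin 2 => if i.val + j.val + 1 = 2 then (1 : L) else 0) v))),
            (∀ u ∈ S, (((Quotient.out u : ↥(«local» L (IsCMField.complexConj L) 2 (Matrix.of fun i j : Fin 2 => if i.val + j.val + 1 = 2 then (1 : L) else 0) v)).val :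
                GL (Fin 2) (UnitaryGroup.LocalRing L v)).val - 1) ^ 2 = 0) →
            mU.IsAdmissibleOn (fun γ : ↥(«local» L (IsCMField.complexConj L) 2 (Matrix.of fun i j : Fin 2 => if i.val + j.val + 1 = 2 then (1 : L) else 0) v) => (ConjClasses.mk γ) ∈ S) →
            ∀ u ∈ S, ∀ F : ↥(«local» L (IsCMField.complexConj L) 2 (Matrix.of fun i j : Fin 2 => if i.val + j.val + 1 = 2 then (1 : L) else 0) v) → ℂ, IsLocSmooth F →
              classOrbitalIntegral mU (U₀.indicator (F ∘ Ψ)) u = q ^ (a u) * classOrbitalIntegral mU F u := by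
  intro L _ _ _ v hns _ _ _ _
  classical
  -- ### the place `w ∣ v`, the local field `K = L_w`, `σ = σ_w`
  obtain ⟨w⟩ := (inferInstance : Nonempty (PlacesOver L v))
  have hw : IsCMField.complexConj L • w.1 = w.1 := hns w
  haveI hquad : Algebra.IsQuadraticExtension ↥(maximalRealSubfield L) L := IsCMField.isQuadraticExtension L
  have hc : IsCMField.complexConj L ≠ 1 := IsCMField.complexConj_ne_one L
  have hσσ : ∀ x : w.1.adicCompletion L, galAdicCompletionMap (L := L) (IsCMField.complexConj L) hw (galAdicCompletionMap (L := L) (IsCMField.complexConj L) hw x) = x :=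
    galAdicCompletionMap_galAdicCompletionMap_of_smul_eq (IsCMField.complexConj L) w hc hw
  have hσv : ∀ a : w.1.adicCompletion L, Valued.v (galAdicCompletionMap (L := L) (IsCMField.complexConj L) hw a) = Valued.v a :=
    fun a => valued_galAdicCompletionMap (L := L) (IsCMField.complexConj L) hw a
  have hJw : placeForm (Matrix.of fun i j : Fin 2 => if i.val + j.val + 1 = 2 then (1 : L) else 0) w.1 = (StdForm.antidiagonal 2).over (w.1.adicCompletion L) := by
    rw [placeForm, antidiagOne_eq_over, StdForm.over_map]
  haveI : CharZero (w.1.adicCompletion L) := charZero_of_injective_algebraMap (algebraMap L (w.1.adicCompletion L)).injective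
  have h2 : (2 : w.1.adicCompletion L) ≠ 0 := two_ne_zero
  -- ### the scalar `t = p`, `k = v_w(p)`, `Q = (#𝓀)^k`
  have ht0 : ((resChar L v : ℕ) : w.1.adicCompletion L) ≠ 0 := Nat.cast_ne_zero.2 (resChar_ne_zero L v)
  have ht1 : Valued.v ((resChar L v : ℕ) : w.1.adicCompletion L) < 1 := valued_natCast_resChar_lt_one L v w
  have hσt : galAdicCompletionMap (L := L) (IsCMField.complexConj L) hw ((resChar L v : ℕ) : w.1.adicCompletion L) = (resChar L v : ℕ) := map_natCast _ _
  obtain ⟨k, hk1, htk⟩ := exists_valued_eq_exp_neg ht0 ht1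
  haveI : Finite (𝓞 L ⧸ w.1.asIdeal) := w.1.asIdeal.finiteQuotientOfFreeOfNeBot w.1.ne_bot
  haveI : Finite 𝓀[w.1.adicCompletion L] := HeightOneSpectrum.finite_residueField_adicCompletion L w.1
  have hQ1 : 1 < Nat.card 𝓀[w.1.adicCompletion L] ^ k := Nat.one_lt_pow (by omega) Finite.one_lt_card
  have hs1 : ‖((resChar L v : ℕ) : w.1.adicCompletion L) * ((resChar L v : ℕ) : w.1.adicCompletion L)‖ < 1 := by
    have h' : ‖((resChar L v : ℕ) : w.1.adicCompletion L)‖ < 1 := Valued.toNormedField.norm_lt_one_iff.2 ht1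
    rw [norm_mul]
    exact mul_lt_one_of_nonneg_of_lt_one_left (norm_nonneg _) h' h'.le
  have hq : 1 < ‖((Nat.card 𝓀[w.1.adicCompletion L] ^ k : ℕ) : ℂ)‖ := by
    rw [Complex.norm_natCast]; exact_mod_cast hQ1
  -- ### the exponents `a u ∈ {0, 1}`
  obtain ⟨a, ha⟩ : ∃ a : ConjClasses (↥(«local» L (IsCMField.complexConj L) 2 (Matrix.of fun i j : Fin 2 => if i.val + j.val + 1 = 2 then (1 : L) else 0) v)) → ℕ, ∀ u, a u =
      (if ((Quotient.out u : ↥(«local» L (IsCMField.complexConj L) 2 (Matrix.of fun i j : Fin 2 => if i.val + j.val + 1 = 2 then (1 : L) else 0) v)).val : GL (Fin 2) (UnitaryGroup.LocalRing L v)).val = 1 then 0 else 1) :=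
    ⟨_, fun _ => rfl⟩
  have hmk : ∀ u : ConjClasses (↥(«local» L (IsCMField.complexConj L) 2 (Matrix.of fun i j : Fin 2 => if i.val + j.val + 1 = 2 then (1 : L) else 0) v)), ConjClasses.mk (Quotient.out u : ↥(«local» L (IsCMField.complexConj L) 2 (Matrix.of fun i j : Fin 2 => if i.val + j.val + 1 = 2 then (1 : L) else 0) v)) = u := fun u => by
    rw [← ConjClasses.quotient_mk_eq_mk, Quotient.out_eq]
  have ha1 : ∀ u : ConjClasses (↥(«local» L (IsCMField.complexConj L) 2 (Matrix.of fun i j : Fin 2 => if i.val + j.val + 1 = 2 then (1 : L) else 0) v)), u ≠ ConjClasses.mk 1 → 1 ≤ a u := by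
    intro u hu1
    rw [ha]
    by_cases h1 : ((Quotient.out u : ↥(«local» L (IsCMField.complexConj L) 2 (Matrix.of fun i j : Fin 2 => if i.val + j.val + 1 = 2 then (1 : L) else 0) v)).val : GL (Fin 2) (UnitaryGroup.LocalRing L v)).val = 1
    · exact absurd ((hmk u).symm.trans (by rw [show (Quotient.out u : ↥(«local» L (IsCMField.complexConj L) 2 (Matrix.of fun i j : Fin 2 => if i.val + j.val + 1 = 2 then (1 : L) else 0) v)) = 1 from Subtype.ext (Units.ext h1)])) hu1
    · rw [if_neg h1]
  refine ⟨w, hw, _, 1 / 2, _, a, by rw [map_mul, hσt], mul_ne_zero ht0 ht0, hs1, by norm_num, by norm_num, hq, ha1, ?_⟩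
  intro Ψ U₀ hU hΨ S mU hunip hadm u hu F hF
  -- ### the model `M = U(σ_w, J_w)(L_w)`, `e`, the ball `B`
  set e : ↥(«local» L (IsCMField.complexConj L) 2 (Matrix.of fun i j : Fin 2 => if i.val + j.val + 1 = 2 then (1 : L) else 0) v) ≃ₜ* ↥(unitaryGroupOfForm (galAdicCompletionMap (L := L) (IsCMField.complexConj L) hw) (placeForm (Matrix.of fun i j : Fin 2 => if i.val + j.val + 1 = 2 then (1 : L) else 0) w.1)) :=
    localNonsplitEquiv (IsCMField.complexConj L) (Matrix.of fun i j : Fin 2 => if i.val + j.val + 1 = 2 then (1 : L) else 0) (IsCMField.complexConj_ne_one L) w hw with he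
  set B : Set ↥(unitaryGroupOfForm (galAdicCompletionMap (L := L) (IsCMField.complexConj L) hw) (placeForm (Matrix.of fun i j : Fin 2 => if i.val + j.val + 1 = 2 then (1 : L) else 0) w.1)) := {m |
    IsUnit ((((m : ↥(unitaryGroupOfForm (galAdicCompletionMap (L := L) (IsCMField.complexConj L) hw) (placeForm (Matrix.of fun i j : Fin 2 => if i.val + j.val + 1 = 2 then (1 : L) else 0) w.1))) : GL (Fin 2) (w.1.adicCompletion L)) : Matrix (Fin 2) (Fin 2) (w.1.adicCompletion L)) + 1).det ∧
    ‖(((((m : ↥(unitaryGroupOfForm (galAdicCompletionMap (L := L) (IsCMField.complexConj L) hw) (placeForm (Matrix.of fun i j : Fin 2 => if i.val + j.val + 1 = 2 then (1 : L) else 0) w.1))) : GL (Fin 2) (w.1.adicCompletion L)) : Matrix (Fin 2) (Fin 2) (w.1.adicCompletion L)) - 1) * ((((m : ↥(unitaryGroupOfForm (galAdicCompletionMap (L := L) (IsCMField.complexConj L) hw) (placeForm (Matrix.of fun i j : Fin 2 => if i.val + j.val + 1 = 2 then (1 : L) else 0) w.1))) : GL (Fin 2) (w.1.adicCompletion L))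 : Matrix (Fin 2) (Fin 2) (w.1.adicCompletion L)) + 1)⁻¹).trace‖ ≤ 1 / 2 ∧
    ‖(((((m : ↥(unitaryGroupOfForm (galAdicCompletionMap (L := L) (IsCMField.complexConj L) hw) (placeForm (Matrix.of fun i j : Fin 2 => if i.val + j.val + 1 = 2 then (1 : L) else 0) w.1))) : GL (Fin 2) (w.1.adicCompletion L)) : Matrix (Fin 2) (Fin 2) (w.1.adicCompletion L)) - 1) * ((((m : ↥(unitaryGroupOfForm (galAdicCompletionMap (L := L) (IsCMField.complexConj L) hw) (placeForm (Matrix.of fun i j : Fin 2 => if i.val + j.val + 1 = 2 then (1 : L) else 0) w.1))) : GL (Fin 2) (w.1.adicCompletion L)) : Matrix (Fin 2) (Fin 2) (w.1.adicCompletion L)) + 1)⁻¹).det‖ ≤ (1 / 2) ^ 2} with hBdef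
  have hB : ∀ m : ↥(unitaryGroupOfForm (galAdicCompletionMap (L := L) (IsCMField.complexConj L) hw) (placeForm (Matrix.of fun i j : Fin 2 => if i.val + j.val + 1 = 2 then (1 : L) else 0) w.1)), m ∈ B ↔
      IsUnit ((((m : ↥(unitaryGroupOfForm (galAdicCompletionMap (L := L) (IsCMField.complexConj L) hw) (placeForm (Matrix.of fun i j : Fin 2 => if i.val + j.val + 1 = 2 then (1 : L) else 0) w.1))) : GL (Fin 2) (w.1.adicCompletion L)) : Matrix (Fin 2) (Fin 2) (w.1.adicCompletion L)) + 1).det ∧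
      ‖(((((m : ↥(unitaryGroupOfForm (galAdicCompletionMap (L := L) (IsCMField.complexConj L) hw) (placeForm (Matrix.of fun i j : Fin 2 => if i.val + j.val + 1 = 2 then (1 : L) else 0) w.1))) : GL (Fin 2) (w.1.adicCompletion L)) : Matrix (Fin 2) (Fin 2) (w.1.adicCompletion L)) - 1) * ((((m : ↥(unitaryGroupOfForm (galAdicCompletionMap (L := L) (IsCMField.complexConj L) hw) (placeForm (Matrix.of fun i j : Fin 2 => if i.val + j.val + 1 = 2 then (1 : L) else 0) w.1))) : GL (Fin 2) (w.1.adicCompletion L)) : Matrix (Fin 2) (Fin 2) (w.1.adicCompletion L)) + 1)⁻¹).trace‖ ≤ 1 / 2 ∧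
      ‖(((((m : ↥(unitaryGroupOfForm (galAdicCompletionMap (L := L) (IsCMField.complexConj L) hw) (placeForm (Matrix.of fun i j : Fin 2 => if i.val + j.val + 1 = 2 then (1 : L) else 0) w.1))) : GL (Fin 2) (w.1.adicCompletion L)) : Matrix (Fin 2) (Fin 2) (w.1.adicCompletion L)) - 1) * ((((m : ↥(unitaryGroupOfForm (galAdicCompletionMap (L := L) (IsCMField.complexConj L) hw) (placeForm (Matrix.of fun i j : Fin 2 => if i.val + j.val + 1 = 2 then (1 : L) else 0) w.1))) : GL (Fin 2) (w.1.adicCompletion L)) : Matrix (Fin 2) (Fin 2) (w.1.adicCompletion L)) + 1)⁻¹).det‖ ≤ (1 / 2) ^ 2 := fun _ => Iff.rfl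
  have hU₀ : ∀ γ : ↥(«local» L (IsCMField.complexConj L) 2 (Matrix.of fun i j : Fin 2 => if i.val + j.val + 1 = 2 then (1 : L) else 0) v), γ ∈ U₀ ↔ e γ ∈ B := hU
  have hρ0 : (0 : ℝ) ≤ 1 / 2 := by norm_num
  have hsρ : ‖((resChar L v : ℕ) : w.1.adicCompletion L) * ((resChar L v : ℕ) : w.1.adicCompletion L)‖ * (1 / 2) < 1 := by
    nlinarith [norm_nonneg (((resChar L v : ℕ) : w.1.adicCompletion L) * ((resChar L v : ℕ) : w.1.adicCompletion L))]
  -- ### the representative `u₀ = out u`, a transvection at `w` (or `1`)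
  have hpow : ∀ n : ℕ, ((((e (Quotient.out u) : ↥(unitaryGroupOfForm (galAdicCompletionMap (L := L) (IsCMField.complexConj L) hw) (placeForm (Matrix.of fun i j : Fin 2 => if i.val + j.val + 1 = 2 then (1 : L) else 0) w.1))) : GL (Fin 2) (w.1.adicCompletion L)) : Matrix (Fin 2) (Fin 2) (w.1.adicCompletion L)) - 1) ^ n =
      (Pi.evalRingHom (fun w' : PlacesOver L v => w'.1.adicCompletion L) w).mapMatrix
        ((((Quotient.out u : ↥(«local» L (IsCMField.complexConj L) 2 (Matrix.of fun i j : Fin 2 => if i.val + j.val + 1 = 2 then (1 : L) else 0) v)).val : GL (Fin 2) (UnitaryGroup.LocalRing L v)).val - 1) ^ n) := fun n => by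
    rw [map_pow, map_sub, map_one, RingHom.mapMatrix_apply]; rfl
  have hinj : ∀ A : Matrix (Fin 2) (Fin 2) (UnitaryGroup.LocalRing L v),
      (Pi.evalRingHom (fun w' : PlacesOver L v => w'.1.adicCompletion L) w).mapMatrix A = 0 → A = 0 := fun A hA => by
    refine Matrix.ext fun i j => ?_
    have hij := congr_fun (congr_fun hA i) j
    rw [RingHom.mapMatrix_apply, Matrix.map_apply, Matrix.zero_apply] at hij
    exact (apply_eq_zero_iff_apply_apply_eq_zero L v w hw (A i j)).2 hij
  have hsq : ((((e (Quotient.out u) : ↥(unitaryGroupOfForm (galAdicCompletionMap (L := L) (IsCMField.complexConj L) hw) (placeForm (Matrix.of fun i j : Fin 2 => if i.val + j.val + 1 = 2 then (1 : L) else 0) w.1))) : GL (Fin 2) (w.1.adicCompletion L)) : Matrix (Fin 2) (Fin 2) (w.1.adicCompletion L)) - 1) * ((((e (Quotient.out u) : ↥(unitaryGroupOfForm (galAdicCompletionMap (L := L) (IsCMField.complexConj L) hw) (placeForm (Matrix.of fun i j : Fin 2 => if i.val + j.val + 1 = 2 then (1 : L) else 0) w.1))) : GL (Fin 2) (w.1.adicCompletion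 L)) : Matrix (Fin 2) (Fin 2) (w.1.adicCompletion L)) - 1) = 0 := by
    rw [← pow_two, hpow, hunip u hu, map_zero]
  have hnil : IsNilpotent ((((e (Quotient.out u) : ↥(unitaryGroupOfForm (galAdicCompletionMap (L := L) (IsCMField.complexConj L) hw) (placeForm (Matrix.of fun i j : Fin 2 => if i.val + j.val + 1 = 2 then (1 : L) else 0) w.1))) : GL (Fin 2) (w.1.adicCompletion L)) : Matrix (Fin 2) (Fin 2) (w.1.adicCompletion L)) - 1) := ⟨2, by rw [pow_two, hsq]⟩
  have hu₀U : (Quotient.out u : ↥(«local» L (IsCMField.complexConj L) 2 (Matrix.of fun i j : Fin 2 => if i.val + j.val + 1 = 2 then (1 : L) else 0) v)) ∈ U₀ := mem_of_isNilpotent hB e hU₀ hρ0 h2 hnil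
  have hE : ∀ γ ∈ U₀, ∀ x : ↥(«local» L (IsCMField.complexConj L) 2 (Matrix.of fun i j : Fin 2 => if i.val + j.val + 1 = 2 then (1 : L) else 0) v), Ψ (x * γ * x⁻¹) = x * Ψ γ * x⁻¹ := fun γ hγ x => map_conj_eq_conj_map_two hB e hU₀ hΨ hsρ hγ x
  have hU' : ∀ x : ↥(«local» L (IsCMField.complexConj L) 2 (Matrix.of fun i j : Fin 2 => if i.val + j.val + 1 = 2 then (1 : L) else 0) v), x * (Quotient.out u : ↥(«local» L (IsCMField.complexConj L) 2 (Matrix.of fun i j : Fin 2 => if i.val + j.val + 1 = 2 then (1 : L) else 0) v)) * x⁻¹ ∈ U₀ := conj_mem_of_isNilpotent hB e hU₀ hρ0 h2 hnil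
  -- ### admissibility of `mU` at `u`, and a two-sided Haar measure on `G`
  obtain ⟨hm0, hinv, hfin⟩ := hadm u (by show ConjClasses.mk (Quotient.out u : ↥(«local» L (IsCMField.complexConj L) 2 (Matrix.of fun i j : Fin 2 => if i.val + j.val + 1 = 2 then (1 : L) else 0) v)) ∈ S; rw [hmk]; exact hu)
  haveI : (Measure.haar : Measure (↥(«local» L (IsCMField.complexConj L) 2 (Matrix.of fun i j : Fin 2 => if i.val + j.val + 1 = 2 then (1 : L) else 0) v))).IsMulRightInvariant :=
    isMulRightInvariant_of_modularCharacterFun_eq_one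
      (fun g => modularCharacter_local_eq_one_of_isotropic L (N := 2) two_ne_zero _ (antidiagOne_isHermitian L 2) (isUnit_antidiagOne_det L 2).ne_zero
        (antidiagOne_isotropic L le_rfl) v g) _
  -- ### the two branches
  by_cases hM1 : ((Quotient.out u : ↥(«local» L (IsCMField.complexConj L) 2 (Matrix.of fun i j : Fin 2 => if i.val + j.val + 1 = 2 then (1 : L) else 0) v)).val : GL (Fin 2) (UnitaryGroup.LocalRing L v)).val = 1
  · -- IDENTITY CLASS: `u = [1]`, `a u = 0`
    have hu1 : u = ConjClasses.mk 1 := (hmk u).symm.trans (by rw [show (Quotient.out u : ↥(«local» L (IsCMField.complexConj L) 2 (Matrix.of fun i j : Fin 2 => if i.val + j.val + 1 = 2 then (1 : L) else 0) v)) = 1 from Subtype.ext (Units.ext hM1)])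
    subst hu1
    have ha0 : a (ConjClasses.mk 1) = 0 := by rw [ha, if_pos]; rw [out_mk_one_eq_one]; rfl
    rw [ha0, pow_zero, one_mul]
    exact classOrbitalIntegral_indicator_comp_eq_of_mk_one (map_one_eq_one_two hB e hU₀ hΨ hρ0 h2) (mem_of_isNilpotent hB e hU₀ hρ0 h2 (by rw [map_one]; exact ⟨1, by simp⟩)) mU F
  · -- TRANSVECTION CLASS: `a u = 1`, ★ FILE 3
    have ha2 : a u = 1 := by rw [ha, if_neg hM1]
    letI : MeasurableSpace ↥(unitaryGroupOfForm (galAdicCompletionMap (L := L) (IsCMField.complexConj L) hw) (placeForm (Matrix.of fun i j : Fin 2 => if i.val + j.val + 1 = 2 then (1 : L) else 0) w.1)) := borel _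
    haveI : BorelSpace ↥(unitaryGroupOfForm (galAdicCompletionMap (L := L) (IsCMField.complexConj L) hw) (placeForm (Matrix.of fun i j : Fin 2 => if i.val + j.val + 1 = 2 then (1 : L) else 0) w.1)) := ⟨rfl⟩
    haveI : CompactSpace 𝒪[w.1.adicCompletion L] := compactSpace_integer_adicCompletion L w.1
    have hne : (((e (Quotient.out u) : ↥(unitaryGroupOfForm (galAdicCompletionMap (L := L) (IsCMField.complexConj L) hw) (placeForm (Matrix.of fun i j : Fin 2 => if i.val + j.val + 1 = 2 then (1 : L) else 0) w.1))) : GL (Fin 2) (w.1.adicCompletion L)) : Matrix (Fin 2) (Fin 2) (w.1.adicCompletion L)) ≠ 1 := by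
      intro h1
      apply hM1
      have h0 := hpow 1
      rw [pow_one, pow_one, h1, sub_self] at h0
      exact sub_eq_zero.1 (hinj _ h0.symm)
    obtain ⟨Om, hOm⟩ : ∃ Om : AddSubgroup (w.1.adicCompletion L), ∀ x, x ∈ Om ↔ galAdicCompletionMap (L := L) (IsCMField.complexConj L) hw x = -x ∧ Valued.v x ≤ 1 :=
      ⟨{ carrier := {x | galAdicCompletionMap (L := L) (IsCMField.complexConj L) hw x = -x ∧ Valued.v x ≤ 1}
         add_mem' := fun {x y} hx hy => ⟨by rw [map_add, hx.1, hy.1, neg_add], (Valuation.map_add _ x y).trans (max_le hx.2 hy.2)⟩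
         zero_mem' := ⟨by rw [map_zero, neg_zero], by rw [map_zero]; exact zero_le⟩
         neg_mem' := fun {x} hx => ⟨by rw [map_neg, hx.1], by rw [Valuation.map_neg]; exact hx.2⟩ }, fun _ => Iff.rfl⟩
    have hFm := relIndex_map_mulLeft_skewBall_eq_pow (IsCMField.complexConj L) hc v w hw hσt htk hOm
    obtain ⟨h', hmat, hZ', K', hK'o, hK'c, ρ', hρ1, hρ2, hρ3, hr'⟩ :=
      exists_haar_index_identity_of_transvection_two (galAdicCompletionMap (L := L) (IsCMField.complexConj L) hw) hJw hσσ hσv h2 ht0 hσt ht1.le hOm hFm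
        (e (Quotient.out u)) hsq hne
    have hΨ' := map_eq_conj_of_coe_conj_eq e hΨ hu₀U hmat
    haveI := hρ1; haveI := hρ2; haveI := hρ3
    obtain ⟨h, Kc, ρ, hΨG, hZG, hKo, hKc, i1, i2, i3, hr⟩ := exists_scalingData_of_continuousMulEquiv e Ψ (Quotient.out u) hΨ' hZ' K' hK'o hK'c ρ' hr'
    haveI := i1; haveI := i2; haveI := i3
    rw [classOrbitalIntegral_indicator_comp_eq_mul_of_conj_of_index Ψ U₀ hE u hU' hΨG hZG Kc hKo hKc ρ hr Measure.haar mU hm0 hinv hfin F, ha2]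
    congr 1
    push_cast
    ring

/-- **DOCKING CERTIFICATE**: the head feeds ★ p855890 `psiPackage_of_scalingLaw_local_two` on the nose (‹Ψ-package›₂ unconditionally; typed out in the sequel). -/
example : True := (fun _ => trivial) (psiPackage_of_scalingLaw_local_two scalingLaw_local_two)

end Summit.HodgeConjecture.HodgeConjecture.Cruxes.H413.K2E3CayleyScalingLawRankOne

end
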